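import Summits.AtomisticToContinuum.BoseEinsteinCondensation.Theorems.BECCutLineWeakDisorderTwoReplicaTransienceBoundFactorisation
import Summits.AtomisticToContinuum.BoseEinsteinCondensation.Theorems.BECCutLineWeakDisorderTwoReplicaTransienceBoundTracerMeasurable
import Summits.AtomisticToContinuum.BoseEinsteinCondensation.Theorems.BECCutLineWeakDisorderTwoReplicaTransienceBoundFreeGas
import Literature.MathematicalPhysics.QuantumManyBody.HeatFlow
import HarnessLib

/-!
# Crux `TwoReplicaTransienceBound` (stmt-AtomisticToContinuum-9687), line `SketchIdeator1` v6:
# the GENERIC INSERTION INEQUALITY (stub `stub_insertionGeneric`)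

Support file (`--supports stmt-AtomisticToContinuum-9687`, lead c3). At a fixed box `Λ_L` and polymer length
`t ≥ 0`, for ANY jointly measurable penalty `P(x, ω₀, y, ω) ≥ 0` with
`1 ≤ e^{-(tagged–bath action)(x,Y,ω₀,ωb)} + Σⱼ P(x, ω₀, Yⱼ, ωbⱼ)`, the killed interaction-weighted lines satisfy
`(∫θ_t) · ∫Z^{(n+1)}_t ≤ ∫Z^{(n+2)}_t + (n+1) · (∫_{x∈Λ} ∫dy ∫dW(ω) ∫dW(ω₀) P) · ∫Z^{(n)}_t`
(`θ_t` = free one-line Dirichlet survival, `Z^{(k)}_t = fkPartition`): inserting one more line costs at most the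
mean penalty. Ingredients (the line's tracer vocabulary): `θ_t(x) ≤ tracer(x,Y,ωb) + 𝟙_Λ(x) Σⱼ ∫P dW(ω₀)`
pointwise; `∫ w · tracer dW = Z^{(n+2)}(x::Y)` (`stub_factorisation`, p97386); the error line by line — relabel
`j ↦ 0` (`lintegral_comp_perm`, `measurePreserving_permPaths`, `fkWeight_comp_perm`) and drop line `0`
from the bath weight (`fkWeight_vecCons_cons ≤ fkWeight`). Specialisations: the sausage penalty (finite range,
hard cores) in `…InsertionStep.lean`; the tangent bound (bounded `v`) in `stub_insertionStepBounded`. No spectral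
input, no smallness: an identity-level statement about the path measure.
-/
noncomputable section

open MeasureTheory Filter Set
open scoped ENNReal NNReal Topology BigOperators

namespace Summit.AtomisticToContinuum.BoseEinsteinCondensation.Cruxes.TwoReplicaTransienceBound.Insertion

open Literature.MathematicalPhysics.QuantumManyBody.BoseGas
open Literature.Probability.Process (brownian runSup runSup_nonneg measurable_runSup abs_brownian_le_runSup)
open Summit.AtomisticToContinuum.BoseEinsteinCondensation.Cruxes.TwoReplicaTransienceBound.TracerDecoupling
open TracerFactorisation TracerMeasurability

variable {n N : ℕ}

/-! ### Relabelling a double integral over slices and samples -/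

/-- **Relabelling a double integral over slices and samples**: `∫ dY ∫ dW(ω) F(Y ∘ σ, ω ∘ σ) = ∫ dY ∫ dW F`
(Lebesgue measure and the Wiener law are products of identical factors: `lintegral_comp_perm`,
`measurePreserving_permPaths`). -/
theorem lintegral_lintegral_relabel (σ : Equiv.Perm (Fin N)) (F : Config N → PathSpace N → ℝ≥0∞) :
    ∫⁻ Y, ∫⁻ ω, F (Y ∘ σ) (permPaths σ ω) ∂wienerPaths N = ∫⁻ Y, ∫⁻ ω, F Y ω ∂wienerPaths N := by
  have hinner : ∀ Y : Config N,
      ∫⁻ ω, F (Y ∘ σ) (permPaths σ ω) ∂wienerPaths N = ∫⁻ ω, F (Y ∘ σ) ω ∂wienerPaths N := fun Y =>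
    (measurePreserving_permPaths σ).lintegral_comp_emb (permPaths σ).measurableEmbedding _
  simp_rw [hinner]
  exact lintegral_comp_perm σ fun Y => ∫⁻ ω, F Y ω ∂wienerPaths N

/-! ### Splitting line `0` off the bath and dropping it from the weight -/

/-- The mass of the bath weight is the partition function: `∫ w(Y, ·) dW = Z(Y)`. -/
theorem lintegral_fkWeight_eq (v : ℝ → ℝ≥0∞) (L t : ℝ) (Y : Config N) :
    ∫⁻ ωb, fkWeight v L t Y ωb ∂wienerPaths N = fkPartition v L t Y := by
  simp only [fkPartition, fkSemigroup, mul_one]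

/-- **Splitting the sample `ωb = ω :: ωb'` of `n + 1` lines** (change of variables
`wienerPaths (n+1) ≅ wienerLine ⊗ wienerPaths n` along `Fin.cons`, Tonelli): for measurable `G ≥ 0`,
`∫ G dW_{n+1} = ∫ dW(ω) ∫ dW_n(ωb') G(ω :: ωb')`. -/
theorem lintegral_wienerPaths_succ {G : PathSpace (n + 1) → ℝ≥0∞} (hG : Measurable G) :
    ∫⁻ ωb, G ωb ∂wienerPaths (n + 1) = ∫⁻ ω, ∫⁻ ωb', G (Fin.cons ω ωb') ∂wienerPaths n ∂wienerLine := by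
  set e := MeasurableEquiv.piFinSuccAbove (fun _ : Fin (n + 1) => Fin 3 → (ℝ≥0 → ℝ)) 0 with he
  have hmp : MeasurePreserving e (wienerPaths (n + 1)) (wienerLine.prod (wienerPaths n)) :=
    measurePreserving_piFinSuccAbove_wienerPaths n
  have hGe : Measurable fun a : (Fin 3 → (ℝ≥0 → ℝ)) × PathSpace n => G (e.symm a) :=
    hG.comp e.symm.measurable
  rw [← hmp.symm.lintegral_comp_emb e.symm.measurableEmbedding]
  change ∫⁻ a, G (e.symm a) ∂wienerLine.prod (wienerPaths n) = _
  rw [lintegral_prod (fun a => G (e.symm a)) hGe.aemeasurable]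
  simp only [he, piFinSuccAbove_symm_apply_eq_cons]

/-- Dropping the tagged factors: `w_{n+1}(y::Y', ω::ωb') ≤ w_n(Y', ωb')` (`fkWeight_vecCons_cons`: the dropped
factor is a survival indicator times `e^{-(action)} ≤ 1`). -/
theorem fkWeight_vecCons_cons_le {v : ℝ → ℝ≥0∞} (hv : Measurable v) (L t : ℝ) (y : Space) (Y' : Config n)
    (ω : Fin 3 → (ℝ≥0 → ℝ)) (ωb' : PathSpace n) :
    fkWeight v L t (Matrix.vecCons y Y') (Fin.cons ω ωb') ≤ fkWeight v L t Y' ωb' := by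
  rw [fkWeight_vecCons_cons hv]
  calc fkWeight v L t Y' ωb' * ((survives (N := 1) L t (fun _ => y)).indicator (fun _ => (1 : ℝ≥0∞))
        (fun _ => ω) * expNeg (taggedBathAction v t y Y' ω ωb'))
      ≤ fkWeight v L t Y' ωb' * (1 * 1) := mul_le_mul' le_rfl
        (mul_le_mul' (Set.indicator_le_self' (fun _ _ => bot_le) _) (expNeg_le_one _))
    _ = fkWeight v L t Y' ωb' := by rw [mul_one, mul_one]

/-- **Dropping line `0` from the bath weight**: for measurable `B ≥ 0` on (start, sample) of ONE line,
`∫ dY ∫ dW_{n+1} w_{n+1}(Y, ωb) · B(Y₀, ωb₀) ≤ (∫ dy ∫ dW B(y, ω)) · ∫ Z^{(n)}` — split `Y = y :: Y'`,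
`ωb = ω :: ωb'`, bound `w_{n+1}(y::Y', ω::ωb') ≤ w_n(Y', ωb')` and integrate (Tonelli). -/
theorem lintegral_fkWeight_mul_zero_le {v : ℝ → ℝ≥0∞} (hv : Measurable v) (L t : ℝ)
    {B : Space → (Fin 3 → (ℝ≥0 → ℝ)) → ℝ≥0∞} (hB : Measurable (Function.uncurry B)) :
    ∫⁻ Y : Config (n + 1), ∫⁻ ωb, fkWeight v L t Y ωb * B (Y 0) (ωb 0) ∂wienerPaths (n + 1) ≤
      (∫⁻ y, ∫⁻ ω, B y ω ∂wienerLine) * ∫⁻ Y' : Config n, fkPartition v L t Y' := by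
  have h1 : Measurable fun a : Config (n + 1) × PathSpace (n + 1) => a.1 0 :=
    (measurable_pi_apply 0).comp measurable_fst
  have h2 : Measurable fun a : Config (n + 1) × PathSpace (n + 1) => a.2 0 :=
    (measurable_pi_apply 0).comp measurable_snd
  have hF : Measurable fun a : Config (n + 1) × PathSpace (n + 1) =>
      fkWeight v L t a.1 a.2 * B (a.1 0) (a.2 0) :=
    (measurable_fkWeight_uncurry hv L t).mul (hB.comp (h1.prodMk h2))
  have hBy : ∀ y : Space, Measurable fun ω : Fin 3 → (ℝ≥0 → ℝ) => B y ω := fun y =>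
    hB.comp ((measurable_const (a := y)).prodMk measurable_id)
  have hFX : ∀ X : Config (n + 1), Measurable fun ωb : PathSpace (n + 1) =>
      fkWeight v L t X ωb * B (X 0) (ωb 0) := fun X =>
    (measurable_fkWeight hv L t X).mul ((hBy (X 0)).comp (measurable_pi_apply 0))
  have hBint : Measurable fun y : Space => ∫⁻ ω, B y ω ∂wienerLine := hB.lintegral_prod_right'
  have hFint : Measurable fun Y : Config (n + 1) =>
      ∫⁻ ωb, fkWeight v L t Y ωb * B (Y 0) (ωb 0) ∂wienerPaths (n + 1) := hF.lintegral_prod_right'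
  -- disintegrate the slice `Y = y :: Y'` (outer) and the sample `ωb = ω :: ωb'` (inner)
  rw [lintegral_eq_lintegral_lintegral_vecCons hFint]
  have hcv : ∀ (y : Space) (Y' : Config n),
      ∫⁻ ωb, fkWeight v L t (Matrix.vecCons y Y') ωb * B (Matrix.vecCons y Y' 0) (ωb 0) ∂wienerPaths (n + 1) =
      ∫⁻ ω, ∫⁻ ωb', fkWeight v L t (Matrix.vecCons y Y') (Fin.cons ω ωb') * B y ω
        ∂wienerPaths n ∂wienerLine := by
    intro y Y'
    rw [lintegral_wienerPaths_succ (hFX _)]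
    simp only [Matrix.cons_val_zero, Fin.cons_zero]
  simp_rw [hcv]
  -- drop line `0` from the weight …
  refine le_trans (lintegral_mono fun Y' => lintegral_mono fun y => lintegral_mono fun ω =>
    lintegral_mono fun ωb' => mul_le_mul' (fkWeight_vecCons_cons_le hv L t y Y' ω ωb') le_rfl) ?_
  -- … and integrate
  have hin : ∀ (Y' : Config n) (y : Space) (ω : Fin 3 → (ℝ≥0 → ℝ)),
      ∫⁻ ωb', fkWeight v L t Y' ωb' * B y ω ∂wienerPaths n = fkPartition v L t Y' * B y ω := by
    intro Y' y ω
    rw [lintegral_mul_const _ (measurable_fkWeight hv L t Y'), lintegral_fkWeight_eq]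
  have hmid : ∀ Y' : Config n, ∫⁻ y, ∫⁻ ω, fkPartition v L t Y' * B y ω ∂wienerLine =
      fkPartition v L t Y' * ∫⁻ y, ∫⁻ ω, B y ω ∂wienerLine := by
    intro Y'
    rw [← lintegral_const_mul _ hBint]
    refine lintegral_congr fun y => ?_
    rw [lintegral_const_mul _ (hBy y)]
  simp_rw [hin, hmid]
  have hZ : Measurable (fkPartition v L t : Config n → ℝ≥0∞) := measurable_fkSemigroup hv L t measurable_const
  rw [lintegral_mul_const _ hZ, mul_comm]

/-- **The relabelled form**: the same bound with line `j` in place of line `0`. -/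
theorem lintegral_fkWeight_mul_le {v : ℝ → ℝ≥0∞} (hv : Measurable v) (L t : ℝ) (j : Fin (n + 1))
    {B : Space → (Fin 3 → (ℝ≥0 → ℝ)) → ℝ≥0∞} (hB : Measurable (Function.uncurry B)) :
    ∫⁻ Y : Config (n + 1), ∫⁻ ωb, fkWeight v L t Y ωb * B (Y j) (ωb j) ∂wienerPaths (n + 1) ≤
      (∫⁻ y, ∫⁻ ω, B y ω ∂wienerLine) * ∫⁻ Y' : Config n, fkPartition v L t Y' := by
  set σ : Equiv.Perm (Fin (n + 1)) := Equiv.swap 0 j with hσ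
  have h := lintegral_lintegral_relabel σ fun (Y : Config (n + 1)) (ωb : PathSpace (n + 1)) =>
    fkWeight v L t Y ωb * B (Y 0) (ωb 0)
  simp only [fkWeight_comp_perm, Function.comp_apply, permPaths_apply, hσ, Equiv.swap_apply_left] at h
  exact h.le.trans (lintegral_fkWeight_mul_zero_le hv L t hB)

/-! ### The generic insertion inequality -/

/-- **Generic insertion inequality.** Let `P(x, ω₀, y, ω) ≥ 0` be jointly measurable and dominate the
tagged–bath Boltzmann factor from below in the sense `1 ≤ e^{-(tagged–bath action)(x,Y,ω₀,ωb)} + Σⱼ P(x,ω₀,Yⱼ,ωbⱼ)`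
for all data. Then, at a fixed box `Λ_L` and polymer length `t ≥ 0`,
`(∫θ_t) · ∫Z^{(n+1)}_t ≤ ∫Z^{(n+2)}_t + (n+1) · (∫_{x∈Λ} ∫dy ∫dW(ω) ∫dW(ω₀) P) · ∫Z^{(n)}_t`
(`θ_t` = free one-line survival). Proof: `θ_t(x) ≤ tracer(x,Y,ωb) + 𝟙_Λ(x) Σⱼ ∫P dW(ω₀)` pointwise (the
tagged line survives only if it starts in `Λ`), times `w(Y,ωb)`, integrated: the main term is
`∫∫ w·tracer = Z^{(n+2)}(x::Y)` (`stub_factorisation`), the error is handled line by line by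
`lintegral_fkWeight_mul_le`. -/
theorem insertion_generic {v : ℝ → ℝ≥0∞} (hv : Measurable v) (L : ℝ) {t : ℝ} (ht : 0 ≤ t)
    (P : Space → (Fin 3 → (ℝ≥0 → ℝ)) → Space → (Fin 3 → (ℝ≥0 → ℝ)) → ℝ≥0∞)
    (hP : Measurable fun q : (Space × (Fin 3 → (ℝ≥0 → ℝ))) × (Space × (Fin 3 → (ℝ≥0 → ℝ))) =>
      P q.1.1 q.1.2 q.2.1 q.2.2)
    (hdom : ∀ (x : Space) (ω₀ : Fin 3 → (ℝ≥0 → ℝ)) (Y : Config (n + 1)) (ωb : PathSpace (n + 1)),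
      1 ≤ expNeg (taggedBathAction v t x Y ω₀ ωb) + ∑ j, P x ω₀ (Y j) (ωb j)) :
    (∫⁻ x, fkPartition (N := 1) (fun _ => 0) L t (fun _ => x)) * ∫⁻ Y : Config (n + 1), fkPartition v L t Y ≤
      (∫⁻ X : Config (n + 2), fkPartition v L t X) +
        ((n : ℝ≥0∞) + 1) *
          (∫⁻ x in box L, ∫⁻ y, ∫⁻ ω, ∫⁻ ω₀, P x ω₀ y ω ∂wienerLine ∂wienerLine) *
          ∫⁻ Y' : Config n, fkPartition v L t Y' := by
  have hPsec : ∀ (x : Space) (y : Space) (ω : Fin 3 → (ℝ≥0 → ℝ)),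
      Measurable fun ω₀ : Fin 3 → (ℝ≥0 → ℝ) => P x ω₀ y ω := by
    intro x y ω
    have hf : Measurable fun ω₀ : Fin 3 → (ℝ≥0 → ℝ) => ((x, ω₀), (y, ω)) :=
      (measurable_prodMk_left (x := x)).prodMk measurable_const
    have h := hP.comp hf
    exact h
  -- `B x y ω = ∫ P x ω₀ y ω dW(ω₀)` is jointly measurable in `(y, ω)`
  have hB : ∀ x : Space, Measurable (Function.uncurry fun (y : Space) (ω : Fin 3 → (ℝ≥0 → ℝ)) =>
      ∫⁻ ω₀, P x ω₀ y ω ∂wienerLine) := by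
    intro x
    have h : Measurable fun q : (Space × (Fin 3 → (ℝ≥0 → ℝ))) × (Fin 3 → (ℝ≥0 → ℝ)) =>
        P x q.2 q.1.1 q.1.2 :=
      hP.comp (((measurable_const (a := x)).prodMk measurable_snd).prodMk measurable_fst)
    exact h.lintegral_prod_right'
  have hBsec : ∀ (x y : Space), Measurable fun ω : Fin 3 → (ℝ≥0 → ℝ) => ∫⁻ ω₀, P x ω₀ y ω ∂wienerLine := by
    intro x y
    have h := (hB x).comp (measurable_prodMk_left (x := y))
    exact h
  -- `G x = ∫ dy ∫ dW(ω) ∫ dW(ω₀) P` is measurable in `x`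
  have hG : Measurable fun x : Space => ∫⁻ y, ∫⁻ ω, ∫⁻ ω₀, P x ω₀ y ω ∂wienerLine ∂wienerLine := by
    have h4 : Measurable fun q : ((Space × Space) × (Fin 3 → (ℝ≥0 → ℝ))) × (Fin 3 → (ℝ≥0 → ℝ)) =>
        P q.1.1.1 q.2 q.1.1.2 q.1.2 :=
      hP.comp (((measurable_fst.comp (measurable_fst.comp measurable_fst)).prodMk measurable_snd).prodMk
        ((measurable_snd.comp (measurable_fst.comp measurable_fst)).prodMk (measurable_snd.comp measurable_fst)))
    exact (h4.lintegral_prod_right').lintegral_prod_right'.lintegral_prod_right'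
  have hθ : Measurable fun x : Space => fkPartition (N := 1) (fun _ => 0) L t (fun _ => x) := by
    have h := FreeGas.measurable_fkPartition_one (v := fun _ => (0 : ℝ≥0∞)) measurable_const L t
    exact h
  have hZ : ∀ N : ℕ, Measurable (fkPartition v L t : Config N → ℝ≥0∞) := fun N =>
    measurable_fkSemigroup hv L t measurable_const
  have hZcons : Measurable fun p : Space × Config (n + 1) => fkPartition v L t (Matrix.vecCons p.1 p.2) := by
    have h := (hZ (n + 2)).comp (measurable_vecCons_prod (n := n + 1))
    exact h
  have hstep2 : ∀ (x : Space) (Y : Config (n + 1)) (ωb : PathSpace (n + 1)),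
      fkPartition (N := 1) (fun _ => 0) L t (fun _ => x) ≤
        tracer v L t x Y ωb + (box L).indicator (fun _ => (1 : ℝ≥0∞)) x *
          ∑ j, ∫⁻ ω₀, P x ω₀ (Y j) (ωb j) ∂wienerLine := by
    intro x Y ωb
    have hpt : ∀ ω₀ : Fin 3 → (ℝ≥0 → ℝ),
        (survives (N := 1) L t (fun _ => x)).indicator (fun _ => (1 : ℝ≥0∞)) (fun _ => ω₀) ≤
          (survives (N := 1) L t (fun _ => x)).indicator (fun _ => (1 : ℝ≥0∞)) (fun _ => ω₀) *
              expNeg (taggedBathAction v t x Y ω₀ ωb) +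
            (box L).indicator (fun _ => (1 : ℝ≥0∞)) x * ∑ j, P x ω₀ (Y j) (ωb j) := by
      intro ω₀
      by_cases hs : (fun _ : Fin 1 => ω₀) ∈ survives (N := 1) L t (fun _ => x)
      · have hx : x ∈ box L := by
          have h0 := hs 0 ⟨le_rfl, ht⟩
          rw [Real.toNNReal_zero, worldLine_zero] at h0
          exact h0 0
        rw [Set.indicator_of_mem hs, Set.indicator_of_mem hx, one_mul, one_mul]
        exact hdom x ω₀ Y ωb
      · rw [Set.indicator_of_notMem hs]
        exact bot_le
    have hIe : Measurable fun ω₀ : Fin 3 → (ℝ≥0 → ℝ) =>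
        (survives (N := 1) L t (fun _ => x)).indicator (fun _ => (1 : ℝ≥0∞)) (fun _ => ω₀) *
          expNeg (taggedBathAction v t x Y ω₀ ωb) := by
      have h := (measurable_tracerIntegrand hv L t Y).comp (measurable_prodMk_left (x := (x, ωb)))
      exact h
    have hsum : Measurable fun ω₀ : Fin 3 → (ℝ≥0 → ℝ) => ∑ j, P x ω₀ (Y j) (ωb j) :=
      Finset.measurable_sum _ fun j _ => hPsec x (Y j) (ωb j)
    have hθx : fkPartition (N := 1) (fun _ => 0) L t (fun _ => x) =
        ∫⁻ ω₀, (survives (N := 1) L t (fun _ => x)).indicator (fun _ => (1 : ℝ≥0∞)) (fun _ => ω₀) ∂wienerLine := by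
      rw [← FreeGas.tracer_free_eq_fkPartition L t x Y ωb, tracer_def]
      simp only [taggedBathAction_zero, expNeg_zero, mul_one]
    rw [hθx, tracer_def]
    refine (lintegral_mono hpt).trans_eq ?_
    rw [lintegral_add_left hIe, lintegral_const_mul _ hsum, lintegral_finsetSum _ fun j _ => hPsec x (Y j) (ωb j)]
  have hstep3 : ∀ (x : Space) (Y : Config (n + 1)),
      fkPartition (N := 1) (fun _ => 0) L t (fun _ => x) * fkPartition v L t Y ≤
        fkPartition v L t (Matrix.vecCons x Y) + (box L).indicator (fun _ => (1 : ℝ≥0∞)) x *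
          ∑ j, ∫⁻ ωb, fkWeight v L t Y ωb * ∫⁻ ω₀, P x ω₀ (Y j) (ωb j) ∂wienerLine ∂wienerPaths (n + 1) := by
    intro x Y
    have hwt : Measurable fun ωb : PathSpace (n + 1) => fkWeight v L t Y ωb * tracer v L t x Y ωb := by
      have h := (stub_tracerMeasurable (n + 1) v hv L t Y).comp (measurable_prodMk_left (x := x))
      exact (measurable_fkWeight hv L t Y).mul h
    have hwB : ∀ j : Fin (n + 1), Measurable fun ωb : PathSpace (n + 1) =>
        fkWeight v L t Y ωb * ∫⁻ ω₀, P x ω₀ (Y j) (ωb j) ∂wienerLine := by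
      intro j
      have h := (hBsec x (Y j)).comp
        (measurable_pi_apply (X := fun _ : Fin (n + 1) => Fin 3 → (ℝ≥0 → ℝ)) j)
      exact (measurable_fkWeight hv L t Y).mul h
    have hwsum : Measurable fun ωb : PathSpace (n + 1) =>
        ∑ j, fkWeight v L t Y ωb * ∫⁻ ω₀, P x ω₀ (Y j) (ωb j) ∂wienerLine :=
      Finset.measurable_sum _ fun j _ => hwB j
    calc fkPartition (N := 1) (fun _ => 0) L t (fun _ => x) * fkPartition v L t Y
        = ∫⁻ ωb, fkWeight v L t Y ωb * fkPartition (N := 1) (fun _ => 0) L t (fun _ => x) ∂wienerPaths (n + 1) := by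
          rw [lintegral_mul_const _ (measurable_fkWeight hv L t Y), lintegral_fkWeight_eq, mul_comm]
      _ ≤ ∫⁻ ωb, (fkWeight v L t Y ωb * tracer v L t x Y ωb + (box L).indicator (fun _ => (1 : ℝ≥0∞)) x *
            ∑ j, fkWeight v L t Y ωb * ∫⁻ ω₀, P x ω₀ (Y j) (ωb j) ∂wienerLine) ∂wienerPaths (n + 1) := by
          refine lintegral_mono fun ωb => ?_
          calc fkWeight v L t Y ωb * fkPartition (N := 1) (fun _ => 0) L t (fun _ => x)
              ≤ fkWeight v L t Y ωb * (tracer v L t x Y ωb + (box L).indicator (fun _ => (1 : ℝ≥0∞)) x *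
                  ∑ j, ∫⁻ ω₀, P x ω₀ (Y j) (ωb j) ∂wienerLine) := mul_le_mul' le_rfl (hstep2 x Y ωb)
            _ = _ := by rw [mul_add, mul_left_comm, Finset.mul_sum]
      _ = fkPartition v L t (Matrix.vecCons x Y) + (box L).indicator (fun _ => (1 : ℝ≥0∞)) x *
            ∑ j, ∫⁻ ωb, fkWeight v L t Y ωb * ∫⁻ ω₀, P x ω₀ (Y j) (ωb j) ∂wienerLine ∂wienerPaths (n + 1) := by
          rw [lintegral_add_left hwt, lintegral_const_mul _ hwsum, lintegral_finsetSum _ fun j _ => hwB j,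
            stub_factorisation (n + 1) v hv L t x Y]
  have hstep4 : ∀ x : Space,
      fkPartition (N := 1) (fun _ => 0) L t (fun _ => x) * ∫⁻ Y : Config (n + 1), fkPartition v L t Y ≤
        (∫⁻ Y : Config (n + 1), fkPartition v L t (Matrix.vecCons x Y)) +
          (box L).indicator (fun _ => (1 : ℝ≥0∞)) x * (((n : ℝ≥0∞) + 1) *
            ((∫⁻ y, ∫⁻ ω, ∫⁻ ω₀, P x ω₀ y ω ∂wienerLine ∂wienerLine) * ∫⁻ Y' : Config n, fkPartition v L t Y')) := by
    intro x
    have hZxY : Measurable fun Y : Config (n + 1) => fkPartition v L t (Matrix.vecCons x Y) := by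
      have h := hZcons.comp (measurable_prodMk_left (x := x))
      exact h
    have hEj : ∀ j : Fin (n + 1), Measurable fun Y : Config (n + 1) =>
        ∫⁻ ωb, fkWeight v L t Y ωb * ∫⁻ ω₀, P x ω₀ (Y j) (ωb j) ∂wienerLine ∂wienerPaths (n + 1) := by
      intro j
      have h1 : Measurable fun a : Config (n + 1) × PathSpace (n + 1) => a.1 j :=
        (measurable_pi_apply j).comp measurable_fst
      have h2 : Measurable fun a : Config (n + 1) × PathSpace (n + 1) => a.2 j :=
        (measurable_pi_apply j).comp measurable_snd
      have h3 := (hB x).comp (h1.prodMk h2)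
      have h : Measurable fun a : Config (n + 1) × PathSpace (n + 1) =>
          fkWeight v L t a.1 a.2 * ∫⁻ ω₀, P x ω₀ (a.1 j) (a.2 j) ∂wienerLine :=
        (measurable_fkWeight_uncurry hv L t).mul h3
      exact h.lintegral_prod_right'
    have hEsum : Measurable fun Y : Config (n + 1) =>
        ∑ j, ∫⁻ ωb, fkWeight v L t Y ωb * ∫⁻ ω₀, P x ω₀ (Y j) (ωb j) ∂wienerLine ∂wienerPaths (n + 1) :=
      Finset.measurable_sum _ fun j _ => hEj j
    calc fkPartition (N := 1) (fun _ => 0) L t (fun _ => x) * ∫⁻ Y : Config (n + 1), fkPartition v L t Y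
        = ∫⁻ Y : Config (n + 1), fkPartition (N := 1) (fun _ => 0) L t (fun _ => x) * fkPartition v L t Y := by
          rw [lintegral_const_mul _ (hZ (n + 1))]
      _ ≤ ∫⁻ Y : Config (n + 1), (fkPartition v L t (Matrix.vecCons x Y) + (box L).indicator (fun _ => (1 : ℝ≥0∞)) x *
            ∑ j, ∫⁻ ωb, fkWeight v L t Y ωb * ∫⁻ ω₀, P x ω₀ (Y j) (ωb j) ∂wienerLine ∂wienerPaths (n + 1)) :=
          lintegral_mono fun Y => hstep3 x Y
      _ = (∫⁻ Y : Config (n + 1), fkPartition v L t (Matrix.vecCons x Y)) + (box L).indicator (fun _ => (1 : ℝ≥0∞)) x *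
            ∑ j, ∫⁻ Y : Config (n + 1), ∫⁻ ωb, fkWeight v L t Y ωb * ∫⁻ ω₀, P x ω₀ (Y j) (ωb j) ∂wienerLine
              ∂wienerPaths (n + 1) := by
          rw [lintegral_add_left hZxY, lintegral_const_mul _ hEsum, lintegral_finsetSum _ fun j _ => hEj j]
      _ ≤ (∫⁻ Y : Config (n + 1), fkPartition v L t (Matrix.vecCons x Y)) + (box L).indicator (fun _ => (1 : ℝ≥0∞)) x *
            ∑ _j : Fin (n + 1), (∫⁻ y, ∫⁻ ω, ∫⁻ ω₀, P x ω₀ y ω ∂wienerLine ∂wienerLine) *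
              ∫⁻ Y' : Config n, fkPartition v L t Y' := by
          gcongr with j
          exact lintegral_fkWeight_mul_le hv L t j (hB x)
      _ = _ := by
          rw [Finset.sum_const, Finset.card_univ, Fintype.card_fin, nsmul_eq_mul, Nat.cast_succ]
  have hA : Measurable fun x : Space => ∫⁻ Y : Config (n + 1), fkPartition v L t (Matrix.vecCons x Y) :=
    hZcons.lintegral_prod_right'
  have herr : Measurable fun x : Space => (box L).indicator (fun _ => (1 : ℝ≥0∞)) x * (((n : ℝ≥0∞) + 1) *
      ((∫⁻ y, ∫⁻ ω, ∫⁻ ω₀, P x ω₀ y ω ∂wienerLine ∂wienerLine) * ∫⁻ Y' : Config n, fkPartition v L t Y')) :=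
    (measurable_const.indicator (measurableSet_box L)).mul (measurable_const.mul (hG.mul measurable_const))
  calc (∫⁻ x, fkPartition (N := 1) (fun _ => 0) L t (fun _ => x)) * ∫⁻ Y : Config (n + 1), fkPartition v L t Y
      = ∫⁻ x, fkPartition (N := 1) (fun _ => 0) L t (fun _ => x) * ∫⁻ Y : Config (n + 1), fkPartition v L t Y := by
        rw [lintegral_mul_const _ hθ]
    _ ≤ ∫⁻ x, ((∫⁻ Y : Config (n + 1), fkPartition v L t (Matrix.vecCons x Y)) +
          (box L).indicator (fun _ => (1 : ℝ≥0∞)) x * (((n : ℝ≥0∞) + 1) *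
            ((∫⁻ y, ∫⁻ ω, ∫⁻ ω₀, P x ω₀ y ω ∂wienerLine ∂wienerLine) * ∫⁻ Y' : Config n, fkPartition v L t Y'))) :=
        lintegral_mono hstep4
    _ = (∫⁻ X : Config (n + 2), fkPartition v L t X) +
          ∫⁻ x in box L, ((n : ℝ≥0∞) + 1) *
            ((∫⁻ y, ∫⁻ ω, ∫⁻ ω₀, P x ω₀ y ω ∂wienerLine ∂wienerLine) * ∫⁻ Y' : Config n, fkPartition v L t Y') := by
        rw [lintegral_add_left hA, lintegral_lintegral_swap hZcons.aemeasurable,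
          ← lintegral_eq_lintegral_lintegral_vecCons (hZ (n + 2)), ← lintegral_indicator (measurableSet_box L)]
        congr 1
        refine lintegral_congr fun x => ?_
        by_cases hx : x ∈ box L
        · simp only [Set.indicator_of_mem hx, one_mul]
        · simp only [Set.indicator_of_notMem hx, zero_mul]
    _ = _ := by
        have hGC : Measurable fun x : Space =>
            (∫⁻ y, ∫⁻ ω, ∫⁻ ω₀, P x ω₀ y ω ∂wienerLine ∂wienerLine) * ∫⁻ Y' : Config n, fkPartition v L t Y' :=
          hG.mul_const _
        congr 1
        rw [lintegral_const_mul _ hGC, lintegral_mul_const _ hG, mul_assoc]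

end Summit.AtomisticToContinuum.BoseEinsteinCondensation.Cruxes.TwoReplicaTransienceBound.Insertion

namespace Summit.AtomisticToContinuum.BoseEinsteinCondensation.Cruxes.TwoReplicaTransienceBound.TracerDecoupling

open Literature.MathematicalPhysics.QuantumManyBody.BoseGas

/-- **Registered stub `stub_insertionGeneric`** (crux stmt-AtomisticToContinuum-9687, line `SketchIdeator1` v6):
the generic insertion inequality `(∫θ_t)·∫Z^{(n+1)}_t ≤ ∫Z^{(n+2)}_t + (n+1)·(∫_{x∈Λ}∫∫∫P)·∫Z^{(n)}_t` for every
jointly measurable penalty `P` dominating the tagged–bath Boltzmann factor (`= Insertion.insertion_generic`). -/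
theorem stub_insertionGeneric :
    ∀ (n : ℕ) (v : ℝ → ENNReal), Measurable v → ∀ (L t : ℝ), 0 ≤ t →
      ∀ (P : Space → (Fin 3 → (NNReal → ℝ)) → Space → (Fin 3 → (NNReal → ℝ)) → ENNReal),
        (Measurable fun q : (Space × (Fin 3 → (NNReal → ℝ))) × (Space × (Fin 3 → (NNReal → ℝ))) =>
          P q.1.1 q.1.2 q.2.1 q.2.2) →
        (∀ (x : Space) (ω₀ : Fin 3 → (NNReal → ℝ)) (Y : Config (n + 1)) (ωb : PathSpace (n + 1)),
          1 ≤ expNeg (taggedBathAction v t x Y ω₀ ωb) + ∑ j, P x ω₀ (Y j) (ωb j)) →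
        (∫⁻ x, @fkPartition 1 (fun _ => 0) L t (fun _ => x)) * ∫⁻ Y : Config (n + 1), fkPartition v L t Y ≤
          (∫⁻ X : Config (n + 2), fkPartition v L t X) +
            ((n : ENNReal) + 1) *
              (∫⁻ x in box L, ∫⁻ y, ∫⁻ ω, ∫⁻ ω₀, P x ω₀ y ω ∂wienerLine ∂wienerLine) *
              ∫⁻ Y' : Config n, fkPartition v L t Y' :=
  fun _ _ hv L _ ht P hP hdom => Insertion.insertion_generic hv L ht P hP hdom

end Summit.AtomisticToContinuum.BoseEinsteinCondensation.Cruxes.TwoReplicaTransienceBound.TracerDecoupling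

end
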